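import Summits.QuantumFields.YangMills.Theorems.BalabanUVNodesN09AtSmallFieldBookkeeping
import Summits.QuantumFields.YangMills.Theorems.BalabanUVNodesN09NestingOfHierAxial
import Literature.MathematicalPhysics.QuantumFieldTheory.Balaban1983to89.B12B0RestrictionNonlinear267

/-!
# NODE N09 [B12] — THE p. 266–267 RIDER `hb0` IS A THEOREM AT THE RECORD: on a solvable small coarse field, `χ^{(2.9)}_j(U) = 1` forces the
# EXCLUDED fluctuation variables at the distinguished bonds `b₀(c)` to be `O(ε₂₉)`-small; dag-n09-w3 g2's small-field-bookkeeping door WITHOUT `hb0`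

Cell `pub-ymgap` (YM-PLAN Track A), seat `pub-ymgap-dag-n09-w4` g3 (D-0149 width seat 4 of node N09); helper of K1⁷ `StabilityBAtRecordR13SepCoPH` =
stmt-QuantumFields-20542 (`--supports`, count-neutral).  [I] = [Balaban1987RG1] (CMP 109), [B7] = [Balaban1985Averaging] (CMP 98), [B11] = [Balaban1985Variational].

WHY.  The Theorem-3 member of N09 at the Stage-13 record, in dag-n09-w3 g2's door with the small-field DOMAINS as bookkeeping sets
(`…N09AtSmallFieldBookkeeping.thm3Member_stage13SepCoPH_atDomAlt_of_rider_of_numerics_of_εreg_eq`, p598357 ✓), displays — besides [B11] Thm 1 (N07's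
content), the selection conventions, (I19) and K0e's analytic inclusion `hreg` — ONE N09-own hypothesis: the p. 266–267 RIDER `hb0` (K0e
`Node00/SmallFieldChi29OfRecord.mem_domAltOfRecord_of_chiFix29_eq_one`): *«The above restrictions imply also restrictions on B′(b₀(c)), with the
constant ε₁ replaced by O(ε₁), because these variables can be expressed in terms of the remaining ones as in the first step.»*  THIS FILE PROVES IT at the
averaging of record `avOfRecord = blockAvg expMeanLogSU`, from this seat's Literature chain `B12B0LoopGeometry267` → `B12B0LoopStructure267` →
`B12B0RestrictionNonlinear267` (the NONLINEAR rider for the (0.4) averaging: the fibre identity `M(U)(c) = M(V^{(j)}(Ū))(c)` pins the variable at `b₀(c)`),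
the [B7] Prop-2 smallness of the critical configuration (dag-n09-w1 g2 `…N09NestingOfHierAxial.hcrit_of_ukExists`, dag-n21-c's `plaqSmall_iter_Uk_level`),
[B11] Thm 1 existence on the domain (`hsolν`, displayed) and NUMERICS on the record's letters (displayed).

WHAT IS PROVED (3 theorems, 0 def, 0 sorry).
* ★★ `hb0_of_hsolν_of_numerics` — w3 g2's binder `hb0` VERBATIM with `ε′ := 10·((d+2)L)·L^{d−1}·θ₀.ε₂₉` (`= 60L⁴ε₂₉` at `d = 4`): for `j < K`, a step-`j` field `U` whose
  average is a solvable small field (`Ū ∈ domAlt_{j+1}`, `hsolν`) and `χ^{(2.9)}_j(U) = 1`, EVERY distinguished variable satisfies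
  `fluctDevOfRecord θ₀.ν K j U (b₀ c) ≤ ε′`, under `0 < εreg`, the two [B7]-numerics of `hcrit_of_ukExists`, `0 ≤ ε₂₉`, and the rider's numerics
  `1640·(2ℓε₂₉ + ℓ²εreg∕(2L²))·L^{2(d−1)} ≤ 1`, `13·(…)·L^{d−1} < δ_N` (`ℓ = (d+2)L`; «ε₀, ε₁ sufficiently small», [I] Thm 3 p. 264).
* ★★ `hχdom_of_hsolν_of_numerics` — the junction's support clause `hχD` at `D := domAlt` (w3 g2's `hχdom_of_crit_of_rider`) with BOTH displayed inputs supplied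
  (`hcrit` by dag-n09-w1 g2 ∕ dag-n21-c, `hb0` here): from `hsolν` + numerics + the threshold ordering only.
* ★★★ `thm3Member_stage13SepCoPH_atDomAlt_of_numerics_of_εreg_eq` — w3 g2's door with `hb0` GONE: N09-side inputs = `hcov` ((181)ˢᵒˡ; theorem for the offer
  `UkSel`), `hsolν` + [B11]×3 (N07), (I19) `hint`, the analytic inclusion `hreg` (K0e), NUMERICS.

HONEST FRAMING.  Count-neutral REDUCTION: one displayed hypothesis of N09's Thm-3 member is now a tree theorem (kernel matrix analysis + torus bookkeeping, the printed
(0.4) averaging); NOTHING else of Bałaban's asserted ([B11] Thm 1, (I19), p. 259's analyticity stay hypotheses); NO carrier re-pointed; A6: no inhabitant at the V18∕V19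
witness claimed (the numerics there are the K0-numerics lane's); N09 NOT discharged; conjunct 1 (Lemma 4) untouched; K0⁷∕K1⁷ NOT closed; counts unmoved (typed 28∕28 ·
discharged 5∕27); one finite four-torus programme at fixed `ε = L^{−K}` per run — R4 closes the conditional rung `BalabanLadder.UV` only; NOT ℝ⁴ ∕ infinite volume ∕ OS;
the Yang–Mills mass gap (Clay) is NOT proved by any of this.
-/

noncomputable section

namespace Summit.QuantumFields.YangMills.BalabanUVNodes.N09B0RiderAtRecord

open MeasureTheory Set
open Literature.MathematicalPhysics.QuantumFieldTheory.Balaban1983to89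
open Literature.MathematicalPhysics.QuantumFieldTheory.Balaban1983to89.T4Continuum (T4Family)
open Literature.MathematicalPhysics.QuantumFieldTheory.Balaban1983to89.DagBinding (WorldP leavesP)
open Literature.MathematicalPhysics.QuantumFieldTheory.Balaban1983to89.Node00
open Literature.MathematicalPhysics.QuantumFieldTheory.Balaban1983to89.B12RTGaugeInvariance254 (liftTransf)
open Literature.MathematicalPhysics.QuantumFieldTheory.Balaban1983to89.GaugeField (gaugeAct)
open Literature.MathematicalPhysics.QuantumFieldTheory.Balaban1983to89.ExpMeanLog (deltaSU expMeanLogSU)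
open Literature.MathematicalPhysics.QuantumFieldTheory.Balaban1983to89.BlockAveraging (Idx loopHol avgFun)
open Literature.MathematicalPhysics.QuantumFieldTheory.Balaban1983to89.B12SmallFieldDomain259 (b0)
open Literature.MathematicalPhysics.QuantumFieldTheory.Balaban1983to89.B12B0RestrictionNonlinear267 (norm_pertVar_b0_le_pow dist1_inv_mul_eq_norm_pertVar)
open N09NestingOfHierAxial (hcrit_of_ukExists hcrit_dom_of_hsolv)
open N09AtSmallFieldBookkeeping (thm3Member_stage13SepCoPH_atDomAlt_of_rider_of_numerics_of_εreg_eq hχdom_of_crit_of_rider)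
open scoped Matrix.Norms.L2Operator

variable {F : T4Family} {N : ℕ} [NeZero N]

/-- ★★ **THE p. 266–267 RIDER AT THE RECORD** (K0e's ∕ dag-n09-w3 g2's displayed `hb0`, VERBATIM, with `ε′ := 10·((d+2)L)·L^{d−1}·ε₂₉`): on a solvable small
coarse field, `χ^{(2.9)}_j(U) = 1` ⇒ the excluded variables at every `b₀(c)` obey `|V^{(j)}(Ū)(b₀ c)⁻¹U(b₀ c) − 1| ≤ ε′` — from the NONLINEAR rider for the (0.4)
averaging (`B12B0RestrictionNonlinear267.norm_pertVar_b0_le_pow`) at `V := V^{(j)}(Ū)` (same average as `U` on the solvable set, `avg_critCfgOfRecord`),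
the [B7] Prop-2 plaquette smallness of `V^{(j)}(Ū)` (`hcrit_of_ukExists`, whence its (0.4) loops are `ℓ²εreg∕(2L²)`-small, `dist1_loopHol_le'`), and numerics.
[cite: Balaban1987RG1, (2.9) p.266 and p.267; Balaban1985Averaging, Prop. 2 (53) p.26] -/
theorem hb0_of_hsolν_of_numerics (θ₀ : Stage13Params F N) (K : ℕ) (g : ℕ → ℝ) (hεreg : 0 < θ₀.ν.εreg)
    (hε3 : (143 * (((((F.P K).d + 4 : ℕ) : ℝ)) ^ 2 / 4) ^ 2) * θ₀.ν.εreg ≤ 1 / 3)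
    (hε2 : 2 * θ₀.ν.εreg ≤ 2 * deltaSU (Fin N) / ((((F.P K).d + 4) * (F.P K).L : ℕ) : ℝ) ^ 2) (hε29 : 0 ≤ θ₀.ε₂₉)
    (hn1 : 1640 * (2 * (((((F.P K).d + 2) * (F.P K).L : ℕ) : ℝ) * θ₀.ε₂₉) +
        ((((F.P K).d + 2) * (F.P K).L : ℕ) : ℝ) ^ 2 / 4 * (2 * θ₀.ν.εreg / ((F.P K).L : ℝ) ^ 2)) * (((F.P K).L : ℝ) ^ ((F.P K).d - 1)) ^ 2 ≤ 1)
    (hn2 : 13 * (2 * (((((F.P K).d + 2) * (F.P K).L : ℕ) : ℝ) * θ₀.ε₂₉) +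
        ((((F.P K).d + 2) * (F.P K).L : ℕ) : ℝ) ^ 2 / 4 * (2 * θ₀.ν.εreg / ((F.P K).L : ℝ) ^ 2)) * ((F.P K).L : ℝ) ^ ((F.P K).d - 1) < deltaSU (Fin N))
    (hsolν : ∀ j < K, ∀ W ∈ domAltOfRecord F N θ₀.ν K (j + 1), UkExists F N K (j + 1) θ₀.ν.εreg W) :
    ∀ j < K, ∀ U : GaugeField (F.P K) j (SU N), (avOfRecord F N K j).avg U ∈ domAltOfRecord F N θ₀.ν K (j + 1) →
      chiβOfRecord₁₃ F N θ₀ K g j U = 1 → ∀ b : PBond (F.P K) j, IsB0 b →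
        fluctDevOfRecord F N θ₀.ν K j U b ≤ 10 * (((((F.P K).d + 2) * (F.P K).L : ℕ) : ℝ) * θ₀.ε₂₉) * ((F.P K).L : ℝ) ^ ((F.P K).d - 1) := by
  intro j hj U havg hχ b hb
  obtain ⟨c, rfl⟩ := hb
  have hjr : j + 1 ≤ (F.P K).m + (F.P K).K := by rw [T4Family.P_m, T4Family.P_K]; have := F.hm; omega
  have hd : 2 ≤ (F.P K).d := by rw [T4Family.P_d]; norm_num
  set W := (avOfRecord F N K j).avg U with hW
  set V := critCfgOfRecord F N θ₀.ν K j W with hV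
  have hsol := hsolν j hj W havg
  -- the same average at `c`
  have hM : avgFun (expMeanLogSU (n := Fin N)) U c = avgFun (expMeanLogSU (n := Fin N)) V c := by
    have h1 : (avOfRecord F N K j).avg V = W := avg_critCfgOfRecord hsol
    have h2 : (avOfRecord F N K j).avg U = W := rfl
    rw [avOfRecord_avg] at h1 h2
    exact (congrFun h2 c).trans (congrFun h1 c).symm
  -- the fluctuation is `ε₂₉`-small off the distinguished bonds
  have hχ' : chiFix29OfRecord F N θ₀.ν θ₀.ε₂₉ K j U = 1 := hχ
  have hF : ∀ b : PBond (F.P K) j, (∀ c' : PBond (F.P K) (j + 1), b ≠ b0 c') →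
      ‖BlockAveragingEMLLinearisedBackground.pertVar V U b‖ ≤ θ₀.ε₂₉ := by
    intro b hb
    have h := (chiFix29OfRecord_eq_one_iff θ₀.ν θ₀.ε₂₉ K j U).1 hχ' b (fun ⟨c', hc'⟩ => hb c' hc'.symm)
    rw [fluctDevOfRecord_apply, ← hW, ← hV, dist1_inv_mul_eq_norm_pertVar] at h
    exact h.le
  -- the background loops are small ([B7] Prop 2 at the record)
  have hL0 : (0 : ℝ) < (F.P K).L := by exact_mod_cast (F.P K).L_pos
  have hcrit : PlaqSmall (2 * θ₀.ν.εreg / ((F.P K).L : ℝ) ^ 2) V :=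
    hcrit_of_ukExists θ₀.ν hεreg hε3 hε2 (by rw [div_mul_cancel₀ _ (by positivity)]) hsol
  have ha : 0 ≤ 2 * θ₀.ν.εreg / ((F.P K).L : ℝ) ^ 2 := by positivity
  have hloops : ∀ i, dist1 (loopHol V c i) ≤ ((((F.P K).d + 2) * (F.P K).L : ℕ) : ℝ) ^ 2 / 4 * (2 * θ₀.ν.εreg / ((F.P K).L : ℝ) ^ 2) :=
    fun i => BlockAveragingEMLProp2.dist1_loopHol_le' ha (fun q => (hcrit q).le) c i
  -- the nonlinear rider
  have h := norm_pertVar_b0_le_pow hjr hd U V c hε29 hM hF hloops hn1 hn2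
  rw [fluctDevOfRecord_apply, ← hW, ← hV, dist1_inv_mul_eq_norm_pertVar]
  exact h

/-- ★★ **THE SUPPORT CLAUSE AT THE SMALL-FIELD DOMAINS, FULLY SUPPLIED** (the junction's `hχD` at `D := domAltOfRecord θ₀.ν K`; dag-n09-w3 g2's
`hχdom_of_crit_of_rider` with BOTH its displayed inputs now theorems — `hcrit` (dag-n09-w1 g2 ∕ dag-n21-c, [B7] Prop 2) and `hb0` (this file)): for `j < K` and a
step-`j` field whose average is a solvable small field, `U ∉ domAlt_j ⇒ χ^{(2.9)}_j(U) = 0` — from `hsolν` ([B11] Thm 1 existence on the domains), the [B7]-numerics, the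
rider's numerics and the threshold ordering `2εreg∕L² + 4·max(ε₂₉, 60L⁴ε₂₉) ≤ ε₀`. [cite: Balaban1987RG1, (2.9) p.266 and p.267; Balaban1988Convergent, p.265; Balaban1985Averaging, Prop. 2 (53) p.26] -/
theorem hχdom_of_hsolν_of_numerics (θ₀ : Stage13Params F N) (K : ℕ) (g : ℕ → ℝ) (hεreg : 0 < θ₀.ν.εreg)
    (hε3 : (143 * (((((F.P K).d + 4 : ℕ) : ℝ)) ^ 2 / 4) ^ 2) * θ₀.ν.εreg ≤ 1 / 3)
    (hε2 : 2 * θ₀.ν.εreg ≤ 2 * deltaSU (Fin N) / ((((F.P K).d + 4) * (F.P K).L : ℕ) : ℝ) ^ 2) (hε29 : 0 ≤ θ₀.ε₂₉)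
    (hn1 : 1640 * (2 * (((((F.P K).d + 2) * (F.P K).L : ℕ) : ℝ) * θ₀.ε₂₉) +
        ((((F.P K).d + 2) * (F.P K).L : ℕ) : ℝ) ^ 2 / 4 * (2 * θ₀.ν.εreg / ((F.P K).L : ℝ) ^ 2)) * (((F.P K).L : ℝ) ^ ((F.P K).d - 1)) ^ 2 ≤ 1)
    (hn2 : 13 * (2 * (((((F.P K).d + 2) * (F.P K).L : ℕ) : ℝ) * θ₀.ε₂₉) +
        ((((F.P K).d + 2) * (F.P K).L : ℕ) : ℝ) ^ 2 / 4 * (2 * θ₀.ν.εreg / ((F.P K).L : ℝ) ^ 2)) * ((F.P K).L : ℝ) ^ ((F.P K).d - 1) < deltaSU (Fin N))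
    (hord : 2 * θ₀.ν.εreg / ((F.P K).L : ℝ) ^ 2 +
      4 * max θ₀.ε₂₉ (10 * (((((F.P K).d + 2) * (F.P K).L : ℕ) : ℝ) * θ₀.ε₂₉) * ((F.P K).L : ℝ) ^ ((F.P K).d - 1)) ≤ θ₀.ν.ε₀)
    (hsolν : ∀ j < K, ∀ W ∈ domAltOfRecord F N θ₀.ν K (j + 1), UkExists F N K (j + 1) θ₀.ν.εreg W) :
    ∀ j < K, ∀ U : GaugeField (F.P K) j (SU N), (avOfRecord F N K j).avg U ∈ domAltOfRecord F N θ₀.ν K (j + 1) →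
      U ∉ domAltOfRecord F N θ₀.ν K j → chiβOfRecord₁₃ F N θ₀ K g j U = 0 :=
  have hL0 : (0 : ℝ) < (F.P K).L := by exact_mod_cast (F.P K).L_pos
  hχdom_of_crit_of_rider θ₀ K g hord
    (hcrit_dom_of_hsolv θ₀.ν hεreg hε3 hε2 (by rw [div_mul_cancel₀ _ (by positivity)]) hsolν)
    (hb0_of_hsolν_of_numerics θ₀ K g hεreg hε3 hε2 hε29 hn1 hn2 hsolν)

/-- ★★★ **dag-n09-w3 g2's SMALL-FIELD-BOOKKEEPING DOOR WITH THE RIDER DISCHARGED** (`…_atDomAlt_of_rider_of_numerics_of_εreg_eq` with `hb0 :=`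
`hb0_of_hsolν_of_numerics` at `ε′ = 10·((d+2)L)·L^{d−1}·ε₂₉`): N09's Theorem-3 member at the Stage-13 record from (181)ˢᵒˡ `hcov`, `hsolν` + [B11] ×3 at one radius (N07),
(I19) `hint`, the analytic inclusion `hreg` ([I] p. 259, K0e), and NUMERICS on the record's letters only.  CONDITIONAL; nothing of Bałaban's asserted; N09 NOT discharged.
[cite: Balaban1987RG1, Thm 3 p.264, p.259, (2.1)–(2.3) p.265, (2.9) p.266 and p.267; Balaban1985Averaging, Prop. 2 (52)–(54) p.26; Balaban1985Variational, Thm 1 (8)–(10) p.279 and (181) p.307] -/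
theorem thm3Member_stage13SepCoPH_atDomAlt_of_numerics_of_εreg_eq (θ : Stage13HParams F N) (h : θ.Provisos₁₃SepCoPH F N) {w : WorldP}
    (hC : w.C = (datumOfRecord₁₃SepCoPH F N θ h).C) (P : B12.RunParams) (hε : 0 < θ.ε₂₉) (heq : θ.toStage13Params.ν.εreg = θ.εbg)
    (hεreg : 0 < θ.toStage13Params.ν.εreg)
    (hε3 : (143 * (((((F.P P.K).d + 4 : ℕ) : ℝ)) ^ 2 / 4) ^ 2) * θ.toStage13Params.ν.εreg ≤ 1 / 3)
    (hε2 : 2 * θ.toStage13Params.ν.εreg ≤ 2 * deltaSU (Fin N) / ((((F.P P.K).d + 4) * (F.P P.K).L : ℕ) : ℝ) ^ 2)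
    (hord : 2 * θ.toStage13Params.ν.εreg / ((F.P P.K).L : ℝ) ^ 2 +
      4 * max θ.toStage13Params.ε₂₉ (10 * (((((F.P P.K).d + 2) * (F.P P.K).L : ℕ) : ℝ) * θ.toStage13Params.ε₂₉) * ((F.P P.K).L : ℝ) ^ ((F.P P.K).d - 1)) ≤
        θ.toStage13Params.ν.ε₀)
    (hn1 : 1640 * (2 * (((((F.P P.K).d + 2) * (F.P P.K).L : ℕ) : ℝ) * θ.toStage13Params.ε₂₉) +
        ((((F.P P.K).d + 2) * (F.P P.K).L : ℕ) : ℝ) ^ 2 / 4 * (2 * θ.toStage13Params.ν.εreg / ((F.P P.K).L : ℝ) ^ 2)) *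
          (((F.P P.K).L : ℝ) ^ ((F.P P.K).d - 1)) ^ 2 ≤ 1)
    (hn2 : 13 * (2 * (((((F.P P.K).d + 2) * (F.P P.K).L : ℕ) : ℝ) * θ.toStage13Params.ε₂₉) +
        ((((F.P P.K).d + 2) * (F.P P.K).L : ℕ) : ℝ) ^ 2 / 4 * (2 * θ.toStage13Params.ν.εreg / ((F.P P.K).L : ℝ) ^ 2)) *
          ((F.P P.K).L : ℝ) ^ ((F.P P.K).d - 1) < deltaSU (Fin N))
    (hcov : ∀ j < P.K, ∀ (v : GaugeTransf (F.P P.K) (j + 1) (SU N)) (W : GaugeField (F.P P.K) (j + 1) (SU N)),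
      UkExists F N P.K (j + 1) θ.toStage13Params.ν.εreg W →
        critCfgOfRecord F N θ.toStage13Params.ν P.K j (gaugeAct v W) = gaugeAct (liftTransf v) (critCfgOfRecord F N θ.toStage13Params.ν P.K j W))
    (hsolν : ∀ j < P.K, ∀ W ∈ domAltOfRecord F N θ.ν P.K (j + 1), UkExists F N P.K (j + 1) θ.toStage13Params.ν.εreg W)
    (hint : ∀ j < P.K, Integrable (betaInputOfRecord F N (TβOfRecord₁₃ F N) (chiβOfRecord₁₃ F N θ.toStage13Params) P.K (gOfRecord₁₃ F N θ.toStage13Params P) j)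
      (fieldMeasure (F.P P.K) j (SU N)))
    (hreg : ∀ j < P.K, domAltOfRecord F N θ.ν P.K (j + 1) ⊆ regSetOfRecord F N P.K j
      (betaInputOfRecord F N (TβOfRecord₁₃ F N) (chiβOfRecord₁₃ F N θ.toStage13Params) P.K (gOfRecord₁₃ F N θ.toStage13Params P) j))
    (h11 : ∀ k, k ≤ P.K → ∀ V ∈ domAltOfRecord F N θ.ν P.K k, UkExists F N P.K k θ.εbg V ∧ UniqueUkOrbit F N P.K k θ.εbg V)
    (hres : ∀ k, k ≤ P.K → HRestrict F N θ.εbg P.K k (domAltOfRecord F N θ.ν P.K k))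
    (huniq : ∀ k, k ≤ P.K → ∀ V ∈ domAltOfRecord F N θ.ν P.K k, ∀ j < k,
      UniqueUkOrbit F N P.K (j + 1) θ.εbg (Averaging.iter (avOfRecord F N P.K) (j + 1) (Uk F N P.K k θ.εbg V))) :
    (leavesP w P).smallCouplings → (leavesP w P).smallFieldInductive :=
  thm3Member_stage13SepCoPH_atDomAlt_of_rider_of_numerics_of_εreg_eq θ h hC P hε heq hεreg hε3 hε2 hord
    (hb0_of_hsolν_of_numerics θ.toStage13Params P.K (gOfRecord₁₃ F N θ.toStage13Params P) hεreg hε3 hε2 hε.le hn1 hn2 hsolν)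
    hcov hsolν hint hreg h11 hres huniq

/-! ## v1.1 (append-only) — the TWO-RADII door with the support clause supplied -/

/-- ★★★ **dag-n09-w3 g2's TWO-RADII SMALL-FIELD-BOOKKEEPING DOOR WITH THE SUPPORT CLAUSE SUPPLIED** (`…_atDomAlt_of_thm1_of_reg8` with `hχdom :=`
`hχdom_of_hsolν_of_numerics` at `hsolν :=` dag-n09-w1 g2's `ukExists_εreg_of_h11_of_reg8`): N09's Theorem-3 member at the Stage-13 record from (181)ˢᵒˡ `hcov`, (I19) `hint`, the
analytic inclusion `hreg` ([I] p. 259), [B11] ×3 at `εbg`, the (8)-membership clause `hreg8` + `0 < εreg ≤ εbg`, and NUMERICS only — NO support clause, NO rider, NO set family, NO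
nesting, NO orbit∕solvability clause, NO hereditary selection, NO axial convention.  CONDITIONAL; nothing of Bałaban's asserted; N09 NOT discharged.
[cite: Balaban1987RG1, Thm 3 p.264, p.259, (2.1)–(2.3) p.265, (2.9)–(2.10) pp.266–267; Balaban1985Averaging, Prop. 2 (53) p.26; Balaban1985Variational, Thm 1 (8)–(10) p.279 and (181) p.307] -/
theorem thm3Member_stage13SepCoPH_atDomAlt_of_thm1_of_reg8_of_numerics (θ : Stage13HParams F N) (h : θ.Provisos₁₃SepCoPH F N) {w : WorldP}
    (hC : w.C = (datumOfRecord₁₃SepCoPH F N θ h).C) (P : B12.RunParams) (hε : 0 < θ.ε₂₉)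
    (hreg8 : ∀ k, k ≤ P.K → ∀ V ∈ domAltOfRecord F N θ.ν P.K k, Uk F N P.K k θ.εbg V ∈ bgReg F N P.K k θ.toStage13Params.ν.εreg)
    (hle : θ.toStage13Params.ν.εreg ≤ θ.εbg) (hεreg : 0 < θ.toStage13Params.ν.εreg)
    (hε3 : (143 * (((((F.P P.K).d + 4 : ℕ) : ℝ)) ^ 2 / 4) ^ 2) * θ.toStage13Params.ν.εreg ≤ 1 / 3)
    (hε2 : 2 * θ.toStage13Params.ν.εreg ≤ 2 * deltaSU (Fin N) / ((((F.P P.K).d + 4) * (F.P P.K).L : ℕ) : ℝ) ^ 2)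
    (hn1 : 1640 * (2 * (((((F.P P.K).d + 2) * (F.P P.K).L : ℕ) : ℝ) * θ.toStage13Params.ε₂₉) +
        ((((F.P P.K).d + 2) * (F.P P.K).L : ℕ) : ℝ) ^ 2 / 4 * (2 * θ.toStage13Params.ν.εreg / ((F.P P.K).L : ℝ) ^ 2)) *
          (((F.P P.K).L : ℝ) ^ ((F.P P.K).d - 1)) ^ 2 ≤ 1)
    (hn2 : 13 * (2 * (((((F.P P.K).d + 2) * (F.P P.K).L : ℕ) : ℝ) * θ.toStage13Params.ε₂₉) +
        ((((F.P P.K).d + 2) * (F.P P.K).L : ℕ) : ℝ) ^ 2 / 4 * (2 * θ.toStage13Params.ν.εreg / ((F.P P.K).L : ℝ) ^ 2)) *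
          ((F.P P.K).L : ℝ) ^ ((F.P P.K).d - 1) < deltaSU (Fin N))
    (hord : 2 * θ.toStage13Params.ν.εreg / ((F.P P.K).L : ℝ) ^ 2 +
      4 * max θ.toStage13Params.ε₂₉ (10 * (((((F.P P.K).d + 2) * (F.P P.K).L : ℕ) : ℝ) * θ.toStage13Params.ε₂₉) * ((F.P P.K).L : ℝ) ^ ((F.P P.K).d - 1)) ≤
        θ.toStage13Params.ν.ε₀)
    (hcov : ∀ j < P.K, ∀ (v : GaugeTransf (F.P P.K) (j + 1) (SU N)) (W : GaugeField (F.P P.K) (j + 1) (SU N)),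
      UkExists F N P.K (j + 1) θ.toStage13Params.ν.εreg W →
        critCfgOfRecord F N θ.toStage13Params.ν P.K j (gaugeAct v W) = gaugeAct (liftTransf v) (critCfgOfRecord F N θ.toStage13Params.ν P.K j W))
    (hint : ∀ j < P.K, Integrable (betaInputOfRecord F N (TβOfRecord₁₃ F N) (chiβOfRecord₁₃ F N θ.toStage13Params) P.K (gOfRecord₁₃ F N θ.toStage13Params P) j)
      (fieldMeasure (F.P P.K) j (SU N)))
    (hreg : ∀ j < P.K, domAltOfRecord F N θ.ν P.K (j + 1) ⊆ regSetOfRecord F N P.K j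
      (betaInputOfRecord F N (TβOfRecord₁₃ F N) (chiβOfRecord₁₃ F N θ.toStage13Params) P.K (gOfRecord₁₃ F N θ.toStage13Params P) j))
    (h11 : ∀ k, k ≤ P.K → ∀ V ∈ domAltOfRecord F N θ.ν P.K k, UkExists F N P.K k θ.εbg V ∧ UniqueUkOrbit F N P.K k θ.εbg V)
    (hres : ∀ k, k ≤ P.K → HRestrict F N θ.εbg P.K k (domAltOfRecord F N θ.ν P.K k))
    (huniq : ∀ k, k ≤ P.K → ∀ V ∈ domAltOfRecord F N θ.ν P.K k, ∀ j < k,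
      UniqueUkOrbit F N P.K (j + 1) θ.εbg (Averaging.iter (avOfRecord F N P.K) (j + 1) (Uk F N P.K k θ.εbg V))) :
    (leavesP w P).smallCouplings → (leavesP w P).smallFieldInductive :=
  N09AtSmallFieldBookkeeping.thm3Member_stage13SepCoPH_atDomAlt_of_thm1_of_reg8 θ h hC P hε hreg8 hle hεreg.le hcov
    (hχdom_of_hsolν_of_numerics θ.toStage13Params P.K (gOfRecord₁₃ F N θ.toStage13Params P) hεreg hε3 hε2 hε.le hn1 hn2 hord
      (N09BackgroundRadiiTransfer.ukExists_εreg_of_h11_of_reg8 θ.toStage13Params.ν θ.εbg P.K h11 hreg8 hle))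
    hint hreg h11 hres huniq

/-- **N09 AT `(w, P)`, TWO-RADII DOOR, own leaf + the inputs above** ⇒ `Dag.B12_main (leavesP w P)`.  CONDITIONAL; N09 NOT discharged.
[cite: Balaban1987RG1, Lemma 4 (3.53) p.280, Thm 3 p.264, p.259, (2.1)–(2.3) p.265, (2.9) p.266 and p.267; Balaban1985Variational, Thm 1 (8)–(10) p.279 and (181) p.307] -/
theorem b12_main_stage13SepCoPH_of_leaf_atDomAlt_of_thm1_of_reg8_of_numerics (θ : Stage13HParams F N) (h : θ.Provisos₁₃SepCoPH F N) {w : WorldP}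
    (hC : w.C = (datumOfRecord₁₃SepCoPH F N θ h).C) (P : B12.RunParams) (h12 : (leavesP w P).b12) (hε : 0 < θ.ε₂₉)
    (hreg8 : ∀ k, k ≤ P.K → ∀ V ∈ domAltOfRecord F N θ.ν P.K k, Uk F N P.K k θ.εbg V ∈ bgReg F N P.K k θ.toStage13Params.ν.εreg)
    (hle : θ.toStage13Params.ν.εreg ≤ θ.εbg) (hεreg : 0 < θ.toStage13Params.ν.εreg)
    (hε3 : (143 * (((((F.P P.K).d + 4 : ℕ) : ℝ)) ^ 2 / 4) ^ 2) * θ.toStage13Params.ν.εreg ≤ 1 / 3)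
    (hε2 : 2 * θ.toStage13Params.ν.εreg ≤ 2 * deltaSU (Fin N) / ((((F.P P.K).d + 4) * (F.P P.K).L : ℕ) : ℝ) ^ 2)
    (hn1 : 1640 * (2 * (((((F.P P.K).d + 2) * (F.P P.K).L : ℕ) : ℝ) * θ.toStage13Params.ε₂₉) +
        ((((F.P P.K).d + 2) * (F.P P.K).L : ℕ) : ℝ) ^ 2 / 4 * (2 * θ.toStage13Params.ν.εreg / ((F.P P.K).L : ℝ) ^ 2)) *
          (((F.P P.K).L : ℝ) ^ ((F.P P.K).d - 1)) ^ 2 ≤ 1)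
    (hn2 : 13 * (2 * (((((F.P P.K).d + 2) * (F.P P.K).L : ℕ) : ℝ) * θ.toStage13Params.ε₂₉) +
        ((((F.P P.K).d + 2) * (F.P P.K).L : ℕ) : ℝ) ^ 2 / 4 * (2 * θ.toStage13Params.ν.εreg / ((F.P P.K).L : ℝ) ^ 2)) *
          ((F.P P.K).L : ℝ) ^ ((F.P P.K).d - 1) < deltaSU (Fin N))
    (hord : 2 * θ.toStage13Params.ν.εreg / ((F.P P.K).L : ℝ) ^ 2 +
      4 * max θ.toStage13Params.ε₂₉ (10 * (((((F.P P.K).d + 2) * (F.P P.K).L : ℕ) : ℝ) * θ.toStage13Params.ε₂₉) * ((F.P P.K).L : ℝ) ^ ((F.P P.K).d - 1)) ≤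
        θ.toStage13Params.ν.ε₀)
    (hcov : ∀ j < P.K, ∀ (v : GaugeTransf (F.P P.K) (j + 1) (SU N)) (W : GaugeField (F.P P.K) (j + 1) (SU N)),
      UkExists F N P.K (j + 1) θ.toStage13Params.ν.εreg W →
        critCfgOfRecord F N θ.toStage13Params.ν P.K j (gaugeAct v W) = gaugeAct (liftTransf v) (critCfgOfRecord F N θ.toStage13Params.ν P.K j W))
    (hint : ∀ j < P.K, Integrable (betaInputOfRecord F N (TβOfRecord₁₃ F N) (chiβOfRecord₁₃ F N θ.toStage13Params) P.K (gOfRecord₁₃ F N θ.toStage13Params P) j)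
      (fieldMeasure (F.P P.K) j (SU N)))
    (hreg : ∀ j < P.K, domAltOfRecord F N θ.ν P.K (j + 1) ⊆ regSetOfRecord F N P.K j
      (betaInputOfRecord F N (TβOfRecord₁₃ F N) (chiβOfRecord₁₃ F N θ.toStage13Params) P.K (gOfRecord₁₃ F N θ.toStage13Params P) j))
    (h11 : ∀ k, k ≤ P.K → ∀ V ∈ domAltOfRecord F N θ.ν P.K k, UkExists F N P.K k θ.εbg V ∧ UniqueUkOrbit F N P.K k θ.εbg V)
    (hres : ∀ k, k ≤ P.K → HRestrict F N θ.εbg P.K k (domAltOfRecord F N θ.ν P.K k))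
    (huniq : ∀ k, k ≤ P.K → ∀ V ∈ domAltOfRecord F N θ.ν P.K k, ∀ j < k,
      UniqueUkOrbit F N P.K (j + 1) θ.εbg (Averaging.iter (avOfRecord F N P.K) (j + 1) (Uk F N P.K k θ.εbg V))) :
    Dag.B12_main (leavesP w P) :=
  Literature.MathematicalPhysics.QuantumFieldTheory.Balaban1983to89.B12NodeKnitRecord8.b12_main_of_leaf_of_thm3Member h12
    (thm3Member_stage13SepCoPH_atDomAlt_of_thm1_of_reg8_of_numerics θ h hC P hε hreg8 hle hεreg hε3 hε2 hn1 hn2 hord hcov hint hreg h11 hres huniq)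

end Summit.QuantumFields.YangMills.BalabanUVNodes.N09B0RiderAtRecord

end
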